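import Mathlib
import HarnessLib
import Summits.NavierStokesRegularity.NavierStokesRegularity.Theorems.QuarterLogPincerColdSmoothingAftermath
import Summits.NavierStokesRegularity.NavierStokesRegularity.Theorems.QuarterLogPincerColdSmoothingColdCube
import Summits.NavierStokesRegularity.NavierStokesRegularity.Theorems.QuarterLogPincerColdSmoothingPressureGauge
import Summits.NavierStokesRegularity.NavierStokesRegularity.Theorems.QuarterLogPincerColdSmoothingSmallEnergy
import Summits.NavierStokesRegularity.NavierStokesRegularity.Theorems.QuarterLogPincerSilencingCostKernel
import Summits.NavierStokesRegularity.NavierStokesRegularity.Theorems.QuarterLogPincerEmberCensusEdge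
import Summits.NavierStokesRegularity.NavierStokesRegularity.Theorems.QuarterLogPincerBeadCensusKernel
import Summits.NavierStokesRegularity.NavierStokesRegularity.Theorems.QuarterLogPincerHelmholtzCentreKernel

/-!
# Route `QuarterLogPincer`, crux `TypeIQuantSubcubicExp` (stmt-NavierStokesRegularity-24077) —
# ASSEMBLY BY NAME of ns-idea-7's E-chain: E1 and Sa♭ UNCONDITIONAL; the cubic rung ⟸ {H2♭, Sc′ (or Sc), B2}

With the three plumbing stubs of `cold_smoothing` proved in the tree (CS1 `stub_coldCube`, CS2 `stub_coldPressureGauge`, CS3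
`stub_smallEnergySmoothing`), its kernel (`hotWitnessNear_of_stubs`, `regularAftermathM_of_stubs`, `terminalEmberM_of_stubsM`), E1a
`EmberCensus.stub_hotWitnessFar`, Sd `SilencingCost.stub_emberReadout`, Sv `SilencingCost.stub_vorticityInequality`, H1
`HelmholtzCentre.stub_helmholtzNearField` and the kernels of `ember_census` / `bead_census` / `silencing_cost` / `vortical_centre`, the chain
`cold_smoothing → ember_census → bead_census → CubicRung` composes over the tree:

* ★ `hotWitness_holds : EmberCensus.HotWitness` — E1 UNCONDITIONAL;
* ★ `regularAftermathM_holds : RegularAftermathM` — Sa♭ UNCONDITIONAL;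
* `terminalEmberM_of_vorticalCentre_of_enstrophyPersistence : VorticalCentre → EnstrophyPersistence → TerminalEmberM` (E2♭ ⟸ Sb + Sc) and
  `terminalEmberM_of_vorticalCentre_of_thickBox` (E2♭ ⟸ Sb + Sc′);
* `flarePersistence_of_vorticalCentre_of_enstrophyPersistence : VorticalCentre → EnstrophyPersistence → BeadCensus.FlarePersistence` (B1 ⟸ Sb + Sc);
* `typeIQuantCubicExp_of_vorticalCentre_of_enstrophyPersistence_of_bpChainRate : VorticalCentre → EnstrophyPersistence → BPChainRate →
  CubicRung.TypeIQuantCubicExp`;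
* ★ `typeIQuantCubicExp_of_shellKernelBound_of_thickBox_of_bpChainRate : HelmholtzCentre.ShellKernelBound → LimitSilence.ThickBoxSilencingCost →
  BeadCensus.BPChainRate → CubicRung.TypeIQuantCubicExp` — the cubic rung modulo exactly {H2♭, Sc′, B2}.

HONEST FRAME: compositions of landed implications between Props about HYPOTHETICAL Type-I classical solutions; H2♭ (potential theory, M),
Sc′/Sc (the load-bearing silencing cost, L, Carleman-type per `Negative/SilencingCostExpSmall`) and B2 (XL) are OPEN; `CubicRung.TypeIQuantCubicExp`
is the cubic rung BELOW the crux; nothing here bears on 24077's truth, W7 or Navier–Stokes regularity (OPEN / not proved).  pub-ns-dss typer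
(g38), `--supports stmt-NavierStokesRegularity-24077`.
-/

noncomputable section

set_option linter.dupNamespace false

namespace Summit.NavierStokesRegularity.NavierStokesRegularity.Cruxes.TypeIQuantSubcubicExp.ColdSmoothing

open Summit.NavierStokesRegularity.NavierStokesRegularity.Cruxes.TypeIQuantSubcubicExp.CubicRung (TypeIQuantCubicExp)
open Summit.NavierStokesRegularity.NavierStokesRegularity.Cruxes.TypeIQuantSubcubicExp.BeadCensus
  (FlarePersistence BPChainRate typeIQuantCubicExp_of_flarePersistence_of_bpChainRate)
open Summit.NavierStokesRegularity.NavierStokesRegularity.Cruxes.TypeIQuantSubcubicExp.EmberCensus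
  (HotWitness TerminalEmberM stub_hotWitnessFar hotWitness_of_far_of_near flarePersistence_of_hotWitness_of_terminalEmberM)
open Summit.NavierStokesRegularity.NavierStokesRegularity.Cruxes.TypeIQuantSubcubicExp.SilencingCost
  (VorticalCentre EnstrophyPersistence stub_emberReadout enstrophyPersistence_of_thickBoxSilencingCost)
open Summit.NavierStokesRegularity.NavierStokesRegularity.Cruxes.TypeIQuantSubcubicExp.LimitSilence (ThickBoxSilencingCost)
open Summit.NavierStokesRegularity.NavierStokesRegularity.Cruxes.TypeIQuantSubcubicExp.HelmholtzCentre
  (ShellKernelBound vorticalCentre_of_shellKernelBound)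

/-- ★ **E1 UNCONDITIONAL**: the hot-witness package `EmberCensus.HotWitness` of `ember_census` (E1a `stub_hotWitnessFar` and E1b
`hotWitnessNear_of_stubs` over the three proved plumbing stubs CS1–CS3). -/
theorem hotWitness_holds : HotWitness :=
  hotWitness_of_far_of_near stub_hotWitnessFar
    (hotWitnessNear_of_stubs stub_coldCube stub_coldPressureGauge stub_smallEnergySmoothing)

/-- ★ **Sa♭ UNCONDITIONAL**: the `M`-capped regular aftermath `RegularAftermathM` (`regularAftermathM_of_stubs` over CS1–CS3). -/
theorem regularAftermathM_holds : RegularAftermathM :=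
  regularAftermathM_of_stubs stub_coldCube stub_coldPressureGauge stub_smallEnergySmoothing

/-- **E2♭ ⟸ Sb + Sc**: `TerminalEmberM` from the vortical centre and enstrophy persistence (Sa♭ is `regularAftermathM_holds`, Sd is
`SilencingCost.stub_emberReadout`). -/
theorem terminalEmberM_of_vorticalCentre_of_enstrophyPersistence (hB : VorticalCentre) (hC : EnstrophyPersistence) :
    TerminalEmberM :=
  terminalEmberM_of_stubsM regularAftermathM_holds hB hC stub_emberReadout

/-- **E2♭ ⟸ Sb + Sc′**: as above with Sc from the NS-free thick-box silencing cost Sc′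
(`SilencingCost.enstrophyPersistence_of_thickBoxSilencingCost`; Sv is a tree theorem). -/
theorem terminalEmberM_of_vorticalCentre_of_thickBox (hB : VorticalCentre) (hS : ThickBoxSilencingCost) : TerminalEmberM :=
  terminalEmberM_of_vorticalCentre_of_enstrophyPersistence hB (enstrophyPersistence_of_thickBoxSilencingCost hS)

/-- **B1 ⟸ Sb + Sc**: flare persistence of `bead_census` (E1 unconditional, E2♭ from Sb + Sc, composed by
`EmberCensus.flarePersistence_of_hotWitness_of_terminalEmberM`). -/
theorem flarePersistence_of_vorticalCentre_of_enstrophyPersistence (hB : VorticalCentre) (hC : EnstrophyPersistence) :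
    FlarePersistence :=
  flarePersistence_of_hotWitness_of_terminalEmberM hotWitness_holds
    (terminalEmberM_of_vorticalCentre_of_enstrophyPersistence hB hC)

/-- **The cubic rung ⟸ Sb + Sc + B2** (`BeadCensus.typeIQuantCubicExp_of_flarePersistence_of_bpChainRate`). -/
theorem typeIQuantCubicExp_of_vorticalCentre_of_enstrophyPersistence_of_bpChainRate (hB : VorticalCentre)
    (hC : EnstrophyPersistence) (hchain : BPChainRate) : TypeIQuantCubicExp :=
  typeIQuantCubicExp_of_flarePersistence_of_bpChainRate
    (flarePersistence_of_vorticalCentre_of_enstrophyPersistence hB hC) hchain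

/-- ★ **The cubic rung ⟸ {H2♭, Sc′, B2}**: `CubicRung.TypeIQuantCubicExp` from the shell-kernel bound H2♭ (Sb by
`HelmholtzCentre.vorticalCentre_of_shellKernelBound`, H1 being a tree theorem), the thick-box silencing cost Sc′ and the Bolzano–Poincaré
chain rate B2 — every other stub of the E-chain is a tree theorem. -/
theorem typeIQuantCubicExp_of_shellKernelBound_of_thickBox_of_bpChainRate (h : ShellKernelBound) (hS : ThickBoxSilencingCost)
    (hchain : BPChainRate) : TypeIQuantCubicExp :=
  typeIQuantCubicExp_of_vorticalCentre_of_enstrophyPersistence_of_bpChainRate (vorticalCentre_of_shellKernelBound h)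
    (enstrophyPersistence_of_thickBoxSilencingCost hS) hchain

end Summit.NavierStokesRegularity.NavierStokesRegularity.Cruxes.TypeIQuantSubcubicExp.ColdSmoothing

end
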